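import Literature.MathematicalPhysics.QuantumFieldTheory.Balaban1983to89.B7Eq123GeneralRec
import Literature.MathematicalPhysics.QuantumFieldTheory.Balaban1983to89.B7Eq162General

/-!
# `Balaban1983to89.B7Eq162GeneralRec` — [Balaban1985Averaging] Sect. E, the estimates (162), (163) and Proposition 6's bound (164) AT A GENERAL REGULAR BACKGROUND, FOR THE RECORD's AVERAGING
# STRUCTURE ([Balaban1987RG1] (0.4)) — the record twin of the engine's `B7Eq162General`, from (161)_rec (`B7Eq123GeneralRec.prop4_generalZ`)

statement-level skeleton of published theorems with citation tags; proofs where landed; nothing here is a claim about the Yang–Mills mass gap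

CITATION HEADER (lean-in-tree rule).  Cell `pub-ymgap`, seat `pub-ymgap-dag-n05-e` g36 (N05-REC LEAD PEN); item R1 ([3] layer): the record twin of `B7Eq162General` (lit-balaban p06 gen 2).
`--kind proof --supports stmt-QuantumFields-20541` (K0⁷; count-neutral; no definition).  Sources READ: [3] = [Balaban1985Averaging] p. 42 (159)–(163), p. 43 Prop. 6 (164), p. 30 (82), p. 34 (110)
(`paper:balaban1985-cmp98-averaging`); [I] = [Balaban1987RG1] (0.4) p. 253.  REUSED BY NAME: the engine's one-step lemma `B7Eq162General.norm_tHol_treeWord_sub_one_le` (generic in the tree word),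
`B7Prop3GeneralAnalyticRec.norm_FcovZ_le_of_tHol` (g35), `B7Eq123GeneralRec` (`prop4_generalZ`, `dbavgCovIterZ_eq_expCfg_logCovIterZ`, `level_dataZ` — g36), `B7Eq92ConcreteRec.val_avgIterZ_mul_eq`
((159) for the record), `B7SectCDGaugeAveragesRec` (`FcovZ`, `wframeZ`, `vcovZ`), engine `B7Prop6Bound` arithmetic, `B7BlockAvgLog.mlog_exp`, `B7Prop1Explicit.exp_sub_one_le_of_le ∕ norm_units_conj_sub_one_le`.

WHAT IS PROVED (sorry-free; `b` plays `ηα₁`; the record's (131) constant `KZ = 2(1+4dL)` replaces print's `2`, so every `2L^jb` of the engine becomes `KZ·L^jb`).  §1 one step at an ARBITRARY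
unit-bounded background for the RECORD's frames (82)∕(110) (single-staircase tree contours `Γ_{y,x}`, `x = y + offZ L r`, TOKEN RULE (T3)): `eq162_oneStepZ` (`log \overline{R_{0,y}V₁} = F(y)`,
`|F(y)| ≤ 4u` for `|A| ≤ ε`, `dLε ≤ u ≤ 1∕256`), `norm_wframeZ_sub_one_le` (`≤ 8u`, frame and inverse), `norm_wframeZ_inv_mul_tHol_sub_one_le` (`≤ 11u`); §2 THE TOWER under the data of
`prop4_generalZ` + the smallness `1024·d·KZ·L^kb ≤ 1`: `level_factsZ`, ★`eq162_generalZ` ((162) as printed: the first equality and `|F_j(x)| ≤ 4dKZ·L^{j+1}b`), `norm_twistZ_general`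
(`≤ 2dKZ·L^{j+1}b`), `norm_frameZ_general` (`≤ 8dKZ·L^{j+1}b`), `norm_frameZInv_mul_twist_general` (`≤ 11dKZ·L^{j+1}b`), `norm_vcovZ_sub_one_le_prod`, ★`eq163_generalZ` (`|v_j(x) − 1|, |v_j(x)⁻¹ − 1| ≤
e^{16dKZ·L^jb} − 1 ≤ 32dKZ·L^jb`), ★★`eq164_generalZ` — PROPOSITION 6's BOUND (164) FOR THE RECORD: `|Ū^k_b(Ū₀^k)_b⁻¹ − 1| ≤ 68·KZ·(d+1)·L^kb`.
HONEST SCOPE.  Port of the engine's estimates to the record's objects with the record's Prop-4 constant; analyticity clause of Prop. 6 NOT typed here; nothing of [3]∕[6]∕[I] asserted beyond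
what is proved; `HThm4Rec` UNDISCHARGED; N05 discharged of record untouched; N07 not claimable; counts unmoved (typed 28∕28 · discharged 8∕28); one finite 𝕋⁴ programme at fixed ε — nothing
continuum ∕ ℝ⁴ ∕ OS ∕ mass gap ∕ Clay.  No `def`, no `instance`, no `notation`, no `sorry`.
-/

set_option autoImplicit false

noncomputable section

open scoped BigOperators
open NormedSpace Finset

namespace Literature.MathematicalPhysics.QuantumFieldTheory.Balaban1983to89.B7Eq162GeneralRec

open B7Prop1Explicit hiding Site
open B7Prop1Explicit renaming Site → SiteZ
open B7Prop2Explicit (pdev c2')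
open B7Prop3Flat (expCfg c3)
open B7Eq92Concrete (tHol)
open MatrixLog
open BlockAveragingZd (IdxZ avgIterZ offZ)
open B7SectCDGaugeAveragesRec (FcovZ wframeZ dbavgCovIterZ vcovZ)
open B7SectEFLinearisationRec (logCovIterZ)
open B7Eq92ConcreteRec (val_avgIterZ_mul_eq vcovZ_succ_apply)
open B7Prop2Rec (AvgClosedZ C0Z)
open B7Prop3FlatRecSide (l1_offZ_le_dL)
open B7Prop3GeneralAnalyticRec (norm_FcovZ_le_of_tHol)
open B7Prop4GeneralLevelsRec (cZ gZ KZ gZ_nonneg)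
open B7Eq123GeneralRec (prop4_generalZ dbavgCovIterZ_eq_expCfg_logCovIterZ level_dataZ)
open B7Eq162General (norm_tHol_treeWord_sub_one_le)
open B7Prop6Bound (mul_sub_one_norm_le prod_one_add_le_exp_sum geom_tail_le)

variable {d : ℕ}
variable {𝔸 : Type*} [NormedRing 𝔸] [NormedAlgebra ℂ 𝔸] [CompleteSpace 𝔸] [NormOneClass 𝔸]

/-! ## §1 One averaging step at an arbitrary unit-bounded background, record frames -/

section OneStep

variable {L : ℕ} {V : SiteZ d → Fin d → 𝔸ˣ} {A : SiteZ d → Fin d → 𝔸} {ε u : ℝ}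

/-- **(162), ONE STEP, AT AN ARBITRARY BACKGROUND, RECORD FRAME** — for `V` unit-bounded, `V₁ = e^{A}` with `|A_b| ≤ ε`, `dLε ≤ u ≤ 1∕256`: the exponent `F(y)` of the record's block frame
`\overline{R_{0,y}V₁} = exp F(y)` ((82)∕(110) on the centred block's tree contours, `FcovZ`∕`wframeZ`) has `|F(y)| ≤ 4u`, and the FIRST EQUALITY of (162) holds: `log \overline{R_{0,y}V₁} = F(y)`.
[cite: Balaban1985Averaging, (162) p.42, (82) p.30, (110) p.34; Balaban1987RG1, (0.4) p.253] -/
theorem eq162_oneStepZ (hL : 1 ≤ L) (hV : ∀ x κ, V x κ ∈ U1 𝔸) (hε : 0 ≤ ε) (hA : ∀ x κ, ‖A x κ‖ ≤ ε)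
    (hu : ((d * L : ℕ) : ℝ) * ε ≤ u) (hu0 : 0 ≤ u) (hu1 : u ≤ 1 / 256) (y : SiteZ d) :
    mlog ((wframeZ L V (expCfg A) y : 𝔸ˣ) : 𝔸) = FcovZ L V (expCfg A) y ∧ ‖FcovZ L V (expCfg A) y‖ ≤ 4 * u := by
  have hF : ‖FcovZ L V (expCfg A) y‖ ≤ 4 * u := by
    have h := norm_FcovZ_le_of_tHol hL V (expCfg A) y (τ := 2 * u)
      (fun r => norm_tHol_treeWord_sub_one_le hV hε hA hu hu0 (by linarith) y (l1_offZ_le_dL L r)) (by linarith)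
    linarith
  refine ⟨?_, hF⟩
  rw [wframeZ, val_expUnit]
  exact B7BlockAvgLog.mlog_exp (hF.trans_lt (by have := Real.log_two_gt_d9; linarith))

/-- **the record's block frame and its inverse are within `8u` of `1`**. [cite: Balaban1985Averaging, (162)–(163) p.42, (27) p.22] -/
theorem norm_wframeZ_sub_one_le (hL : 1 ≤ L) (hV : ∀ x κ, V x κ ∈ U1 𝔸) (hε : 0 ≤ ε) (hA : ∀ x κ, ‖A x κ‖ ≤ ε)
    (hu : ((d * L : ℕ) : ℝ) * ε ≤ u) (hu0 : 0 ≤ u) (hu1 : u ≤ 1 / 256) (y : SiteZ d) :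
    ‖((wframeZ L V (expCfg A) y : 𝔸ˣ) : 𝔸) - 1‖ ≤ 8 * u ∧ ‖(((wframeZ L V (expCfg A) y)⁻¹ : 𝔸ˣ) : 𝔸) - 1‖ ≤ 8 * u := by
  have hF := (eq162_oneStepZ hL hV hε hA hu hu0 hu1 y).2
  have h8 : Real.exp (4 * u) - 1 ≤ 8 * u := by
    have := exp_sub_one_le_of_le (le_refl (4 * u)) (by linarith) (by linarith); linarith
  refine ⟨?_, ?_⟩
  · rw [wframeZ, val_expUnit]
    exact (norm_exp_sub_one_le_of_norm_le hF).1.trans h8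
  · rw [wframeZ, val_inv_expUnit, val_expUnit]
    exact (norm_exp_sub_one_le_of_norm_le ((norm_neg _).le.trans hF)).1.trans h8

/-- **the level factor `(\overline{R_{0,y}V₁})⁻¹·(R_{0,y}V₁)(Γ_{y,x})` is within `11u` of `1`** for `x ∈ B(y)` (`|Γ_{y,x}| ≤ dL`). [cite: Balaban1985Averaging, (159)–(162) p.42] -/
theorem norm_wframeZ_inv_mul_tHol_sub_one_le (hL : 1 ≤ L) (hV : ∀ x κ, V x κ ∈ U1 𝔸) (hε : 0 ≤ ε)
    (hA : ∀ x κ, ‖A x κ‖ ≤ ε) (hu : ((d * L : ℕ) : ℝ) * ε ≤ u) (hu0 : 0 ≤ u) (hu1 : u ≤ 1 / 256) (y : SiteZ d)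
    {v : SiteZ d} (hv : l1 v ≤ d * L) :
    ‖(((wframeZ L V (expCfg A) y)⁻¹ * tHol V (expCfg A) y (treeWord v) : 𝔸ˣ) : 𝔸) - 1‖ ≤ 11 * u := by
  have h1 := (norm_wframeZ_sub_one_le hL hV hε hA hu hu0 hu1 y).2
  have h2 := norm_tHol_treeWord_sub_one_le hV hε hA hu hu0 (by linarith) y hv
  rw [Units.val_mul]
  refine (mul_sub_one_norm_le _ _).trans ?_
  have ha : 0 ≤ ‖(((wframeZ L V (expCfg A) y)⁻¹ : 𝔸ˣ) : 𝔸) - 1‖ := norm_nonneg _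
  have hb : 0 ≤ ‖((tHol V (expCfg A) y (treeWord v) : 𝔸ˣ) : 𝔸) - 1‖ := norm_nonneg _
  nlinarith [mul_le_mul h1 h2 hb (by linarith)]

end OneStep

/-! ## §2 The tower at a general regular background, for the record: (162), (163), (164) from (161)_rec -/

section Tower

variable {L : ℕ} {s : ℕ} {G : Subgroup 𝔸ˣ} {k : ℕ} {U₀ : SiteZ d → Fin d → 𝔸ˣ} {α₀ : ℝ} {B : SiteZ d → Fin d → 𝔸} {b : ℝ}

/-- the per-level smallness for the record: `1024·d·KZ·L^kb ≤ 1` gives `u_j := dKZ·L^{j+1}b ≤ 1∕256` for `j < k` and `16dKZ·L^jb ≤ 1∕64` for `j ≤ k` (print: «for α₁ sufficiently small»).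
[cite: Balaban1985Averaging, (162)–(163) p.42] -/
private theorem level_smallZ (hL : 2 ≤ L) (hb : 0 ≤ b) (hsm : 1024 * (d : ℝ) * KZ d L * ((L : ℝ) ^ k * b) ≤ 1) :
    (∀ j < k, (d : ℝ) * KZ d L * ((L : ℝ) ^ (j + 1) * b) ≤ 1 / 256) ∧
      ∀ j ≤ k, 16 * (d : ℝ) * KZ d L * ((L : ℝ) ^ j * b) ≤ 1 / 64 := by
  have hL1 : (1 : ℝ) ≤ L := by exact_mod_cast le_trans (by norm_num) hL
  have hmono : ∀ j ≤ k, (L : ℝ) ^ j * b ≤ (L : ℝ) ^ k * b := fun j hj =>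
    mul_le_mul_of_nonneg_right (pow_le_pow_right₀ hL1 hj) hb
  have hd : (0 : ℝ) ≤ d := Nat.cast_nonneg d
  have hK : 0 ≤ KZ d L := by unfold KZ; have := gZ_nonneg d L; positivity
  have hdK : 0 ≤ (d : ℝ) * KZ d L := mul_nonneg hd hK
  refine ⟨fun j hj => ?_, fun j hj => ?_⟩
  · have := mul_le_mul_of_nonneg_left (hmono (j + 1) hj) hdK
    nlinarith
  · have := mul_le_mul_of_nonneg_left (hmono j hj) (by positivity : (0 : ℝ) ≤ 16 * d * KZ d L)
    nlinarith

/-- `dL·(KZ·L^jb) = dKZ·L^{j+1}b` (the `u` of §1 at level `j`, `ε_j = KZ·L^jb` being (161)_rec). [cite: Balaban1985Averaging, (161)–(162) p.42] -/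
private theorem dL_mul_epsZ (j : ℕ) : ((d * L : ℕ) : ℝ) * (KZ d L * ((L : ℝ) ^ j * b)) = (d : ℝ) * KZ d L * ((L : ℝ) ^ (j + 1) * b) := by
  push_cast; ring

/-- **THE LEVEL DATA BEHIND (162) FOR THE RECORD** (from `B7Eq123GeneralRec`): under the hypotheses of `prop4_generalZ`, at every level `j ≤ k` the background `Ū₀ʲ` is unit-bounded, `U̿′ʲ = e^{Q_j}`
bondwise and (161)_rec `|Q_j| ≤ KZ·L^jb`. [cite: Balaban1985Averaging, (161) p.42, (127) p.37; Balaban1987RG1, (0.4) p.253] -/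
theorem level_factsZ (hLs : L = 2 * s + 1) (hs : 1 ≤ s) (hd : 1 ≤ d) (hG : AvgClosedZ d L G) (hU₀ : ∀ x κ, U₀ x κ ∈ G) (hα : 0 < α₀)
    (hα3 : C0Z d * α₀ ≤ 1 / 3) (hα4 : 4 * α₀ ≤ c2' d L) (h52 : pdev U₀ < α₀ * (((L : ℝ) ^ k)⁻¹) ^ 2)
    (hb : 0 ≤ b) (hB : ∀ x κ, ‖B x κ‖ ≤ b)
    (hsmall : Real.exp (4 * cZ d * α₀) * (1 + 2 * (131072 * ((d : ℝ) + 1) ^ 2) * (KZ d L) ^ 2 * ((L : ℝ) ^ k * b)) ≤ 2)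
    (hc₃ : KZ d L * ((L : ℝ) ^ k * b) ≤ c3 d L) :
    ∀ j ≤ k, (∀ x κ, avgIterZ L U₀ j x κ ∈ U1 𝔸) ∧
      dbavgCovIterZ L U₀ (expCfg B) j = expCfg (logCovIterZ L U₀ B j) ∧
      ∀ z κ, ‖logCovIterZ L U₀ B j z κ‖ ≤ KZ d L * ((L : ℝ) ^ j * b) := fun j hj =>
  ⟨(level_dataZ L (by omega) hG k U₀ hU₀ hα hα3 hα4 h52 j hj).1,
    dbavgCovIterZ_eq_expCfg_logCovIterZ L hLs hs hd hG k U₀ hU₀ hα hα3 hα4 h52 B hb hB hsmall hc₃ j hj,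
    (prop4_generalZ L hLs hs hd hG k U₀ hU₀ hα hα3 hα4 h52 B hb hB hsmall hc₃ j hj).2.2⟩

/-- ★ **(162) AT A GENERAL REGULAR BACKGROUND, FOR THE RECORD** — for every level `j < k` and every block centre: the FIRST EQUALITY `(1∕i) log(\overline{R̄^j_{0,x}U̿′^j}) = F_j(x)` (`FcovZ`) and the
bound `|F_j(x)| ≤ 4dKZ·L^{j+1}b` (print's `O(1)α₁L^{j+1}η` with the record's (131) constant), under the data of `prop4_generalZ` and `1024·d·KZ·L^kb ≤ 1`.
[cite: Balaban1985Averaging, (162) p.42; Balaban1987RG1, (0.4) p.253] -/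
theorem eq162_generalZ (hLs : L = 2 * s + 1) (hs : 1 ≤ s) (hd : 1 ≤ d) (hG : AvgClosedZ d L G) (hU₀ : ∀ x κ, U₀ x κ ∈ G) (hα : 0 < α₀)
    (hα3 : C0Z d * α₀ ≤ 1 / 3) (hα4 : 4 * α₀ ≤ c2' d L) (h52 : pdev U₀ < α₀ * (((L : ℝ) ^ k)⁻¹) ^ 2)
    (hb : 0 ≤ b) (hB : ∀ x κ, ‖B x κ‖ ≤ b)
    (hsmall : Real.exp (4 * cZ d * α₀) * (1 + 2 * (131072 * ((d : ℝ) + 1) ^ 2) * (KZ d L) ^ 2 * ((L : ℝ) ^ k * b)) ≤ 2)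
    (hc₃ : KZ d L * ((L : ℝ) ^ k * b) ≤ c3 d L) (hsm : 1024 * (d : ℝ) * KZ d L * ((L : ℝ) ^ k * b) ≤ 1)
    {j : ℕ} (hj : j < k) (y : SiteZ d) :
    mlog ((wframeZ L (avgIterZ L U₀ j) (dbavgCovIterZ L U₀ (expCfg B) j) y : 𝔸ˣ) : 𝔸)
        = FcovZ L (avgIterZ L U₀ j) (dbavgCovIterZ L U₀ (expCfg B) j) y ∧
      ‖FcovZ L (avgIterZ L U₀ j) (dbavgCovIterZ L U₀ (expCfg B) j) y‖ ≤ 4 * (d : ℝ) * KZ d L * ((L : ℝ) ^ (j + 1) * b) := by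
  have hL2 : 2 ≤ L := by omega
  have hL1 : 1 ≤ L := by omega
  obtain ⟨hV, hW, hQ⟩ := level_factsZ hLs hs hd hG hU₀ hα hα3 hα4 h52 hb hB hsmall hc₃ j hj.le
  have hu1 := (level_smallZ (d := d) hL2 hb hsm).1 j hj
  have hK : 0 ≤ KZ d L := by unfold KZ; have := gZ_nonneg d L; positivity
  rw [hW]
  have h := eq162_oneStepZ (V := avgIterZ L U₀ j) (A := logCovIterZ L U₀ B j) hL1 hV (by positivity) hQ
    (le_of_eq (dL_mul_epsZ j)) (by positivity) hu1 y
  exact ⟨h.1, h.2.trans (le_of_eq (by ring))⟩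

/-- **the twisted transport of (159) at level `j < k` is within `2dKZ·L^{j+1}b` of `1`** for every tree contour with `|Γ| ≤ dL`, for the record. [cite: Balaban1985Averaging, (159)–(162) p.42] -/
theorem norm_twistZ_general (hLs : L = 2 * s + 1) (hs : 1 ≤ s) (hd : 1 ≤ d) (hG : AvgClosedZ d L G) (hU₀ : ∀ x κ, U₀ x κ ∈ G) (hα : 0 < α₀)
    (hα3 : C0Z d * α₀ ≤ 1 / 3) (hα4 : 4 * α₀ ≤ c2' d L) (h52 : pdev U₀ < α₀ * (((L : ℝ) ^ k)⁻¹) ^ 2)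
    (hb : 0 ≤ b) (hB : ∀ x κ, ‖B x κ‖ ≤ b)
    (hsmall : Real.exp (4 * cZ d * α₀) * (1 + 2 * (131072 * ((d : ℝ) + 1) ^ 2) * (KZ d L) ^ 2 * ((L : ℝ) ^ k * b)) ≤ 2)
    (hc₃ : KZ d L * ((L : ℝ) ^ k * b) ≤ c3 d L) (hsm : 1024 * (d : ℝ) * KZ d L * ((L : ℝ) ^ k * b) ≤ 1)
    {j : ℕ} (hj : j < k) (y : SiteZ d) {v : SiteZ d} (hv : l1 v ≤ d * L) :
    ‖((tHol (avgIterZ L U₀ j) (dbavgCovIterZ L U₀ (expCfg B) j) y (treeWord v) : 𝔸ˣ) : 𝔸) - 1‖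
      ≤ 2 * (d : ℝ) * KZ d L * ((L : ℝ) ^ (j + 1) * b) := by
  have hL2 : 2 ≤ L := by omega
  obtain ⟨hV, hW, hQ⟩ := level_factsZ hLs hs hd hG hU₀ hα hα3 hα4 h52 hb hB hsmall hc₃ j hj.le
  have hu1 := (level_smallZ (d := d) hL2 hb hsm).1 j hj
  have hK : 0 ≤ KZ d L := by unfold KZ; have := gZ_nonneg d L; positivity
  rw [hW]
  have h := norm_tHol_treeWord_sub_one_le (V := avgIterZ L U₀ j) (A := logCovIterZ L U₀ B j) hV (by positivity) hQ
    (le_of_eq (dL_mul_epsZ j)) (by positivity) (by linarith) y hv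
  linarith

/-- **the record's block frames (160) at level `j < k` and their inverses are within `8dKZ·L^{j+1}b` of `1`**. [cite: Balaban1985Averaging, (160)–(163) p.42] -/
theorem norm_frameZ_general (hLs : L = 2 * s + 1) (hs : 1 ≤ s) (hd : 1 ≤ d) (hG : AvgClosedZ d L G) (hU₀ : ∀ x κ, U₀ x κ ∈ G) (hα : 0 < α₀)
    (hα3 : C0Z d * α₀ ≤ 1 / 3) (hα4 : 4 * α₀ ≤ c2' d L) (h52 : pdev U₀ < α₀ * (((L : ℝ) ^ k)⁻¹) ^ 2)
    (hb : 0 ≤ b) (hB : ∀ x κ, ‖B x κ‖ ≤ b)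
    (hsmall : Real.exp (4 * cZ d * α₀) * (1 + 2 * (131072 * ((d : ℝ) + 1) ^ 2) * (KZ d L) ^ 2 * ((L : ℝ) ^ k * b)) ≤ 2)
    (hc₃ : KZ d L * ((L : ℝ) ^ k * b) ≤ c3 d L) (hsm : 1024 * (d : ℝ) * KZ d L * ((L : ℝ) ^ k * b) ≤ 1)
    {j : ℕ} (hj : j < k) (y : SiteZ d) :
    ‖((wframeZ L (avgIterZ L U₀ j) (dbavgCovIterZ L U₀ (expCfg B) j) y : 𝔸ˣ) : 𝔸) - 1‖ ≤ 8 * (d : ℝ) * KZ d L * ((L : ℝ) ^ (j + 1) * b) ∧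
      ‖(((wframeZ L (avgIterZ L U₀ j) (dbavgCovIterZ L U₀ (expCfg B) j) y)⁻¹ : 𝔸ˣ) : 𝔸) - 1‖ ≤ 8 * (d : ℝ) * KZ d L * ((L : ℝ) ^ (j + 1) * b) := by
  have hL2 : 2 ≤ L := by omega
  have hL1 : 1 ≤ L := by omega
  obtain ⟨hV, hW, hQ⟩ := level_factsZ hLs hs hd hG hU₀ hα hα3 hα4 h52 hb hB hsmall hc₃ j hj.le
  have hu1 := (level_smallZ (d := d) hL2 hb hsm).1 j hj
  have hK : 0 ≤ KZ d L := by unfold KZ; have := gZ_nonneg d L; positivity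
  rw [hW]
  have h := norm_wframeZ_sub_one_le (V := avgIterZ L U₀ j) (A := logCovIterZ L U₀ B j) hL1 hV (by positivity) hQ
    (le_of_eq (dL_mul_epsZ j)) (by positivity) hu1 y
  constructor <;> linarith [h.1, h.2]

/-- **the level factor `(\overline{R̄^j_{0,y}U̿′^j})⁻¹(R̄^j_{0,y}U̿′^j)(Γ_{y,x})` at level `j < k` is within `11dKZ·L^{j+1}b` of `1`**, for the record. [cite: Balaban1985Averaging, (159)–(162) p.42] -/
theorem norm_frameZInv_mul_twist_general (hLs : L = 2 * s + 1) (hs : 1 ≤ s) (hd : 1 ≤ d) (hG : AvgClosedZ d L G) (hU₀ : ∀ x κ, U₀ x κ ∈ G)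
    (hα : 0 < α₀) (hα3 : C0Z d * α₀ ≤ 1 / 3) (hα4 : 4 * α₀ ≤ c2' d L) (h52 : pdev U₀ < α₀ * (((L : ℝ) ^ k)⁻¹) ^ 2)
    (hb : 0 ≤ b) (hB : ∀ x κ, ‖B x κ‖ ≤ b)
    (hsmall : Real.exp (4 * cZ d * α₀) * (1 + 2 * (131072 * ((d : ℝ) + 1) ^ 2) * (KZ d L) ^ 2 * ((L : ℝ) ^ k * b)) ≤ 2)
    (hc₃ : KZ d L * ((L : ℝ) ^ k * b) ≤ c3 d L) (hsm : 1024 * (d : ℝ) * KZ d L * ((L : ℝ) ^ k * b) ≤ 1)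
    {j : ℕ} (hj : j < k) (y : SiteZ d) {v : SiteZ d} (hv : l1 v ≤ d * L) :
    ‖((((wframeZ L (avgIterZ L U₀ j) (dbavgCovIterZ L U₀ (expCfg B) j) y)⁻¹
        * tHol (avgIterZ L U₀ j) (dbavgCovIterZ L U₀ (expCfg B) j) y (treeWord v) : 𝔸ˣ) : 𝔸)) - 1‖
      ≤ 11 * (d : ℝ) * KZ d L * ((L : ℝ) ^ (j + 1) * b) := by
  have hL2 : 2 ≤ L := by omega
  have hL1 : 1 ≤ L := by omega
  obtain ⟨hV, hW, hQ⟩ := level_factsZ hLs hs hd hG hU₀ hα hα3 hα4 h52 hb hB hsmall hc₃ j hj.le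
  have hu1 := (level_smallZ (d := d) hL2 hb hsm).1 j hj
  have hK : 0 ≤ KZ d L := by unfold KZ; have := gZ_nonneg d L; positivity
  rw [hW]
  have h := norm_wframeZ_inv_mul_tHol_sub_one_le (V := avgIterZ L U₀ j) (A := logCovIterZ L U₀ B j) hL1 hV (by positivity)
    hQ (le_of_eq (dL_mul_epsZ j)) (by positivity) hu1 y hv
  linarith

omit [NormOneClass 𝔸] in
/-- (160) multiplied out for the record: if every factor `\overline{R̄^l_{0,·}U̿′^l}`, `l < j`, and its inverse are within `φ_l ≥ 0` of `1`, then `|v_j(x) − 1|, |v_j(x)⁻¹ − 1| ≤ Π_{l<j}(1 + φ_l) − 1`.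
[cite: Balaban1985Averaging, (160) p.42, (163) p.42] -/
theorem norm_vcovZ_sub_one_le_prod (L : ℕ) (U₀ U₁ : SiteZ d → Fin d → 𝔸ˣ) {φ : ℕ → ℝ} (hφ0 : ∀ l, 0 ≤ φ l) :
    ∀ (j : ℕ), (∀ l < j, ∀ t : SiteZ d,
        ‖((wframeZ L (avgIterZ L U₀ l) (dbavgCovIterZ L U₀ U₁ l) t : 𝔸ˣ) : 𝔸) - 1‖ ≤ φ l ∧
        ‖(((wframeZ L (avgIterZ L U₀ l) (dbavgCovIterZ L U₀ U₁ l) t)⁻¹ : 𝔸ˣ) : 𝔸) - 1‖ ≤ φ l) →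
      ∀ y : SiteZ d, ‖((vcovZ L U₀ U₁ j y : 𝔸ˣ) : 𝔸) - 1‖ ≤ (∏ l ∈ range j, (1 + φ l)) - 1 ∧
        ‖(((vcovZ L U₀ U₁ j y)⁻¹ : 𝔸ˣ) : 𝔸) - 1‖ ≤ (∏ l ∈ range j, (1 + φ l)) - 1
  | 0, _, y => by simp
  | j + 1, hfr, y => by
      have ih := norm_vcovZ_sub_one_le_prod L U₀ U₁ hφ0 j (fun l hl t => hfr l (Nat.lt_succ_of_lt hl) t) ((L : ℤ) • y)
      have hj := hfr j (Nat.lt_succ_self j) ((L : ℤ) • y)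
      have hP : 0 ≤ ∏ l ∈ range j, (1 + φ l) := Finset.prod_nonneg fun l _ => by linarith [hφ0 l]
      rw [vcovZ_succ_apply, Finset.prod_range_succ]
      constructor
      · rw [Units.val_mul]
        refine (mul_sub_one_norm_le _ _).trans ?_
        have h1 : 1 + ‖((vcovZ L U₀ U₁ j ((L : ℤ) • y) : 𝔸ˣ) : 𝔸) - 1‖ ≤ ∏ l ∈ range j, (1 + φ l) := by linarith [ih.1]
        have h2 : 1 + ‖((wframeZ L (avgIterZ L U₀ j) (dbavgCovIterZ L U₀ U₁ j) ((L : ℤ) • y) : 𝔸ˣ) : 𝔸) - 1‖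
            ≤ 1 + φ j := by linarith [hj.1]
        nlinarith [mul_le_mul h1 h2 (by positivity) hP]
      · rw [mul_inv_rev, Units.val_mul]
        refine (mul_sub_one_norm_le _ _).trans ?_
        have h1 : 1 + ‖(((vcovZ L U₀ U₁ j ((L : ℤ) • y))⁻¹ : 𝔸ˣ) : 𝔸) - 1‖ ≤ ∏ l ∈ range j, (1 + φ l) := by
          linarith [ih.2]
        have h2 : 1 + ‖(((wframeZ L (avgIterZ L U₀ j) (dbavgCovIterZ L U₀ U₁ j) ((L : ℤ) • y))⁻¹ : 𝔸ˣ) : 𝔸) - 1‖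
            ≤ 1 + φ j := by linarith [hj.2]
        nlinarith [mul_le_mul h2 h1 (by positivity) (by linarith [hφ0 j])]

/-- ★ **(163) AT A GENERAL REGULAR BACKGROUND FOR THE RECORD** — for every `j ≤ k` and every site of the `j`-th lattice, `|v_j(x) − 1|` and `|v_j(x)⁻¹ − 1|` are `≤ e^{16dKZ·L^jb} − 1 ≤ 32dKZ·L^jb`
(the frames within `8dKZ·L^{l+1}b` of `1`, `Σ_{l<j}L^{l+1} ≤ 2L^j`). [cite: Balaban1985Averaging, (163) p.42; Balaban1987RG1, (0.4) p.253] -/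
theorem eq163_generalZ (hLs : L = 2 * s + 1) (hs : 1 ≤ s) (hd : 1 ≤ d) (hG : AvgClosedZ d L G) (hU₀ : ∀ x κ, U₀ x κ ∈ G) (hα : 0 < α₀)
    (hα3 : C0Z d * α₀ ≤ 1 / 3) (hα4 : 4 * α₀ ≤ c2' d L) (h52 : pdev U₀ < α₀ * (((L : ℝ) ^ k)⁻¹) ^ 2)
    (hb : 0 ≤ b) (hB : ∀ x κ, ‖B x κ‖ ≤ b)
    (hsmall : Real.exp (4 * cZ d * α₀) * (1 + 2 * (131072 * ((d : ℝ) + 1) ^ 2) * (KZ d L) ^ 2 * ((L : ℝ) ^ k * b)) ≤ 2)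
    (hc₃ : KZ d L * ((L : ℝ) ^ k * b) ≤ c3 d L) (hsm : 1024 * (d : ℝ) * KZ d L * ((L : ℝ) ^ k * b) ≤ 1)
    {j : ℕ} (hj : j ≤ k) (y : SiteZ d) :
    (‖((vcovZ L U₀ (expCfg B) j y : 𝔸ˣ) : 𝔸) - 1‖ ≤ Real.exp (16 * (d : ℝ) * KZ d L * ((L : ℝ) ^ j * b)) - 1 ∧
      ‖(((vcovZ L U₀ (expCfg B) j y)⁻¹ : 𝔸ˣ) : 𝔸) - 1‖ ≤ Real.exp (16 * (d : ℝ) * KZ d L * ((L : ℝ) ^ j * b)) - 1) ∧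
      Real.exp (16 * (d : ℝ) * KZ d L * ((L : ℝ) ^ j * b)) - 1 ≤ 32 * (d : ℝ) * KZ d L * ((L : ℝ) ^ j * b) := by
  have hL2 : 2 ≤ L := by omega
  have hLr : (2 : ℝ) ≤ L := by exact_mod_cast hL2
  have hd0 : (0 : ℝ) ≤ d := Nat.cast_nonneg d
  have hK : 0 ≤ KZ d L := by unfold KZ; have := gZ_nonneg d L; positivity
  set φ : ℕ → ℝ := fun l => 8 * (d : ℝ) * KZ d L * ((L : ℝ) ^ (l + 1) * b) with hφ
  have hφ0 : ∀ l, 0 ≤ φ l := fun l => by positivity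
  have hfr : ∀ l < j, ∀ t : SiteZ d,
      ‖((wframeZ L (avgIterZ L U₀ l) (dbavgCovIterZ L U₀ (expCfg B) l) t : 𝔸ˣ) : 𝔸) - 1‖ ≤ φ l ∧
      ‖(((wframeZ L (avgIterZ L U₀ l) (dbavgCovIterZ L U₀ (expCfg B) l) t)⁻¹ : 𝔸ˣ) : 𝔸) - 1‖ ≤ φ l :=
    fun l hl t => norm_frameZ_general hLs hs hd hG hU₀ hα hα3 hα4 h52 hb hB hsmall hc₃ hsm (lt_of_lt_of_le hl hj) t
  have hv := norm_vcovZ_sub_one_le_prod L U₀ (expCfg B) hφ0 j hfr y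
  have hsum : ∑ l ∈ range j, φ l ≤ 16 * (d : ℝ) * KZ d L * ((L : ℝ) ^ j * b) := by
    have hgeom := geom_tail_le (L : ℝ) hLr j
    have hLj : (0 : ℝ) < (L : ℝ) ^ j := by positivity
    have hterm : ∀ l ∈ range j, φ l = (8 * (d : ℝ) * KZ d L * ((L : ℝ) ^ j * b)) * ((L : ℝ) ^ (l + 1) / (L : ℝ) ^ j) := by
      intro l _; rw [hφ]; field_simp
    rw [Finset.sum_congr rfl hterm, ← Finset.mul_sum]
    have h0 : 0 ≤ 8 * (d : ℝ) * KZ d L * ((L : ℝ) ^ j * b) := by positivity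
    nlinarith [mul_le_mul_of_nonneg_left hgeom h0]
  have hprod : (∏ l ∈ range j, (1 + φ l)) - 1 ≤ Real.exp (16 * (d : ℝ) * KZ d L * ((L : ℝ) ^ j * b)) - 1 := by
    linarith [(prod_one_add_le_exp_sum φ j hφ0).trans (Real.exp_le_exp.2 hsum)]
  have h32 : Real.exp (16 * (d : ℝ) * KZ d L * ((L : ℝ) ^ j * b)) - 1 ≤ 32 * (d : ℝ) * KZ d L * ((L : ℝ) ^ j * b) := by
    have hs' := (level_smallZ (d := d) hL2 hb hsm).2 j hj
    have := exp_sub_one_le_of_le (le_refl (16 * (d : ℝ) * KZ d L * ((L : ℝ) ^ j * b))) (by positivity) hs'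
    linarith
  exact ⟨⟨hv.1.trans hprod, hv.2.trans hprod⟩, h32⟩

/-- ★★ **PROPOSITION 6, THE BOUND (164) AT A GENERAL REGULAR BACKGROUND, FOR THE RECORD** — «|\overline{U′U₀}^k(Ū₀^k)⁻¹ − 1| < O(1)α₁»: under the data of `prop4_generalZ` (`U′ = e^{B}`, `sup|B| ≤ b`
playing `ηα₁`) and `1024·d·KZ·L^kb ≤ 1`, at every bond of the `k`-th lattice `|Ū^k_b(Ū₀^k)_b⁻¹ − 1| ≤ 68·KZ·(d+1)·L^kb` — by (159) for the record (`val_avgIterZ_mul_eq`), (161)_rec for `U̿′^k`,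
(163)_rec for `v_k`, and `|R(u)X − 1| ≤ |X − 1|` for the unit-bounded `u = (Ū₀^k)_b`. [cite: Balaban1985Averaging, Proposition 6 (164) p.43, (159) p.42; Balaban1987RG1, (0.4) p.253] -/
theorem eq164_generalZ (hLs : L = 2 * s + 1) (hs : 1 ≤ s) (hd : 1 ≤ d) (hG : AvgClosedZ d L G) (hU₀ : ∀ x κ, U₀ x κ ∈ G) (hα : 0 < α₀)
    (hα3 : C0Z d * α₀ ≤ 1 / 3) (hα4 : 4 * α₀ ≤ c2' d L) (h52 : pdev U₀ < α₀ * (((L : ℝ) ^ k)⁻¹) ^ 2)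
    (hb : 0 ≤ b) (hB : ∀ x κ, ‖B x κ‖ ≤ b)
    (hsmall : Real.exp (4 * cZ d * α₀) * (1 + 2 * (131072 * ((d : ℝ) + 1) ^ 2) * (KZ d L) ^ 2 * ((L : ℝ) ^ k * b)) ≤ 2)
    (hc₃ : KZ d L * ((L : ℝ) ^ k * b) ≤ c3 d L) (hsm : 1024 * (d : ℝ) * KZ d L * ((L : ℝ) ^ k * b) ≤ 1)
    (z : SiteZ d) (κ : Fin d) :
    ‖((avgIterZ L (expCfg B * U₀) k z κ : 𝔸ˣ) : 𝔸) * (((avgIterZ L U₀ k z κ)⁻¹ : 𝔸ˣ) : 𝔸) - 1‖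
      ≤ 68 * KZ d L * ((d : ℝ) + 1) * ((L : ℝ) ^ k * b) := by
  obtain ⟨hV, hW, hQ⟩ := level_factsZ hLs hs hd hG hU₀ hα hα3 hα4 h52 hb hB hsmall hc₃ k le_rfl
  obtain ⟨⟨hv, -⟩, h32⟩ := eq163_generalZ hLs hs hd hG hU₀ hα hα3 hα4 h52 hb hB hsmall hc₃ hsm le_rfl z
  obtain ⟨⟨-, hv'⟩, -⟩ := eq163_generalZ hLs hs hd hG hU₀ hα hα3 hα4 h52 hb hB hsmall hc₃ hsm le_rfl (z + e κ)
  set x : ℝ := (L : ℝ) ^ k * b with hx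
  have hx0 : 0 ≤ x := by positivity
  have hd0 : (0 : ℝ) ≤ d := Nat.cast_nonneg d
  have hd1 : (1 : ℝ) ≤ d := by exact_mod_cast hd
  have hK : 0 ≤ KZ d L := by unfold KZ; have := gZ_nonneg d L; positivity
  -- smallness: `32dKZ·x ≤ 1∕32`, `KZ·x ≤ 1∕64`
  have hdx : 32 * (d : ℝ) * KZ d L * x ≤ 1 / 32 := by rw [hx]; nlinarith
  have hKx : KZ d L * x ≤ 1 / 64 := by
    rw [hx]
    have : KZ d L * ((L : ℝ) ^ k * b) ≤ (d : ℝ) * KZ d L * ((L : ℝ) ^ k * b) := by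
      have h0 : 0 ≤ KZ d L * ((L : ℝ) ^ k * b) := by positivity
      nlinarith
    nlinarith
  -- the middle factor `(U̿′^k)_b = e^{Q_k(b)}` within `e^{KZ x} − 1 ≤ 2KZ x` of `1`
  have hWb : ‖((dbavgCovIterZ L U₀ (expCfg B) k z κ : 𝔸ˣ) : 𝔸) - 1‖ ≤ 2 * (KZ d L * x) := by
    rw [hW]
    simp only [expCfg, val_expUnit]
    have h := (norm_exp_sub_one_le_of_norm_le (hQ z κ)).1
    exact h.trans (exp_sub_one_le_of_le (le_refl _) (by positivity) hKx)
  -- (159) for the record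
  have h159 : ((avgIterZ L (expCfg B * U₀) k z κ : 𝔸ˣ) : 𝔸) * (((avgIterZ L U₀ k z κ)⁻¹ : 𝔸ˣ) : 𝔸)
      = ((vcovZ L U₀ (expCfg B) k z : 𝔸ˣ) : 𝔸) * ((dbavgCovIterZ L U₀ (expCfg B) k z κ : 𝔸ˣ) : 𝔸)
        * (((avgIterZ L U₀ k z κ : 𝔸ˣ) : 𝔸) * (((vcovZ L U₀ (expCfg B) k (z + e κ))⁻¹ : 𝔸ˣ) : 𝔸)
          * (((avgIterZ L U₀ k z κ)⁻¹ : 𝔸ˣ) : 𝔸)) := by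
    rw [val_avgIterZ_mul_eq]
    simp only [mul_assoc]
  have hR : ‖((avgIterZ L U₀ k z κ : 𝔸ˣ) : 𝔸) * (((vcovZ L U₀ (expCfg B) k (z + e κ))⁻¹ : 𝔸ˣ) : 𝔸)
        * (((avgIterZ L U₀ k z κ)⁻¹ : 𝔸ˣ) : 𝔸) - 1‖ ≤ 32 * d * KZ d L * x :=
    (norm_units_conj_sub_one_le (hV z κ) _).trans (hv'.trans h32)
  have hvx : ‖((vcovZ L U₀ (expCfg B) k z : 𝔸ˣ) : 𝔸) - 1‖ ≤ 32 * d * KZ d L * x := hv.trans h32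
  rw [h159]
  refine (mul_sub_one_norm_le _ _).trans ?_
  have hA : 1 + ‖((vcovZ L U₀ (expCfg B) k z : 𝔸ˣ) : 𝔸) * ((dbavgCovIterZ L U₀ (expCfg B) k z κ : 𝔸ˣ) : 𝔸) - 1‖
      ≤ (1 + 32 * d * KZ d L * x) * (1 + 2 * (KZ d L * x)) := by
    have hin := mul_sub_one_norm_le ((vcovZ L U₀ (expCfg B) k z : 𝔸ˣ) : 𝔸) ((dbavgCovIterZ L U₀ (expCfg B) k z κ : 𝔸ˣ) : 𝔸)
    have := mul_le_mul (add_le_add_left hvx 1) (add_le_add_left hWb 1) (by positivity) (by positivity)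
    linarith
  have hBd : 1 + ‖((avgIterZ L U₀ k z κ : 𝔸ˣ) : 𝔸) * (((vcovZ L U₀ (expCfg B) k (z + e κ))⁻¹ : 𝔸ˣ) : 𝔸)
        * (((avgIterZ L U₀ k z κ)⁻¹ : 𝔸ˣ) : 𝔸) - 1‖ ≤ 1 + 32 * d * KZ d L * x := by linarith
  have h2x : 2 * (KZ d L * x) ≤ 1 / 32 := by linarith
  have hax : 0 ≤ 32 * (d : ℝ) * KZ d L * x := by positivity
  have hmx : 0 ≤ KZ d L * x := by positivity
  calc _ ≤ (1 + 32 * d * KZ d L * x) * (1 + 2 * (KZ d L * x)) * (1 + 32 * d * KZ d L * x) - 1 := by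
        nlinarith [mul_le_mul hA hBd (by positivity) (by positivity)]
    _ ≤ 68 * KZ d L * ((d : ℝ) + 1) * x := by
        nlinarith [mul_nonneg hax hmx, mul_nonneg (mul_nonneg hax hax) hmx, mul_nonneg hax hax]

end Tower

end Literature.MathematicalPhysics.QuantumFieldTheory.Balaban1983to89.B7Eq162GeneralRec
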